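import Summits.KontsevichZagierPeriods.KontsevichZagierPeriods.Theorems.UnfoldedStokesStokesGenerationStubIsotopyTransport2Aux

/-!
# `StokesGeneration` (stmt-KontsevichZagierPeriods-3586) — line `fibrewise_stokes`, stub `stub_isotopyTransport2`

Registered stub T1 (rung 2″) of the line `fibrewise_stokes` of the crux `StokesGeneration` (route
UnfoldedStokes): **the three-element transport certificate for the change-of-variables relator of
Kontsevich–Zagier's rule (2) in dimension two**, on the closed cube `[0,1]³` (coordinates
`x₀, x₁` of the square and the isotopy parameter `u = x₂`).

Let `Φ = id + V` be a `C²` self-map of the square `[0,1]²` preserving each edge (`Vᵢ = 0` and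
`∂_{1−i} Vᵢ = 0` on `{xᵢ ∈ {0,1}}`), `W i j = ∂ⱼVᵢ`, `M i = ∂₀∂₁Vᵢ = ∂₁∂₀Vᵢ`, and `f` a `C¹`
integrand near the square, everything `ℚ`-semialgebraic and continuous on the square. Along the
straight-line isotopy `Φᵤ = id + u V` (which stays in the square by convexity) put
`Jᵤ = det DΦᵤ = (1 + u W₀₀)(1 + u W₁₁) − u W₀₁ · u W₁₀` and `C = adj(DΦᵤ) V`, i.e.
`C₀ = (1 + u W₁₁) V₀ − u W₀₁ V₁`, `C₁ = (1 + u W₀₀) V₁ − u W₁₀ V₀`. The two-dimensional Liouville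
(continuity) identity `∂ᵤ[(f∘Φᵤ) Jᵤ] = ∂₀[(f∘Φᵤ) C₀] + ∂₁[(f∘Φᵤ) C₁]` (a polynomial identity in
`f, ∂f, V, W, M` at the isotopy point, using `∂₀W_{i1} = ∂₁W_{i0} = Mᵢ`) says that the primitives
`G₀ = (f∘Φᵤ) Jᵤ` (direction `u`), `G₁ = −(f∘Φᵤ) C₁` (direction `x₁`), `G₂ = −(f∘Φᵤ) C₀`
(direction `x₀`) have fibre derivatives `D₀ + D₁ + D₂ = 0`. The fluxes `C₁`, `C₀` vanish on the
edges `x₁ ∈ {0,1}`, `x₀ ∈ {0,1}` respectively (face hypotheses), while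
`G₀|_{u=1} − G₀|_{u=0} = f(Φ p) J₁(p) − f(p)`. Hence `f(p) − f(Φ p) det DΦ(p)` is the sum of the
three fibrewise Stokes elements `Dⱼ − (Gⱼ|_{top} − Gⱼ|_{bottom})`, carried by the closed cube with
continuous (hence bounded and integrable) `ℚ`-semialgebraic data; semialgebraicity of `f∘Φᵤ`,
`∂f∘Φᵤ` is composition with a semialgebraic map (Bochnak–Coste–Roy, Prop. 2.2.6). The calculus
and the semialgebraic bookkeeping are in the auxiliary file `…StubIsotopyTransport2Aux`.

References: M. Kontsevich, D. Zagier, *Periods* (2001), §1.2, rule (2); J. Ayoub, *Une version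
relative de la conjecture des périodes de Kontsevich–Zagier*, Ann. of Math. 181 (2015), Rem. 1.5;
J. Bochnak, M. Coste, M.-F. Roy, *Real Algebraic Geometry* (1998), Prop. 2.2.6.
-/

noncomputable section

-- `Summit.KontsevichZagierPeriods.KontsevichZagierPeriods.…` is the tree's mandated layout (single-conjunct summit).
set_option linter.dupNamespace false

namespace Summit.KontsevichZagierPeriods.KontsevichZagierPeriods.Cruxes.StokesGeneration.FibrewiseStokes

open MeasureTheory Set
open Literature.NumberTheory.Transcendental
open Literature.NumberTheory.Transcendental.KZ
open Literature.ModelTheory.ExponentialFields (IsSemialgebraic)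

/-- **Registered stub `stub_isotopyTransport2` (rung 2″, T1): the two-dimensional transport
certificate.** For `f` of class `C¹` near the square, a `C²` displacement `V` (`Φ = id + V` maps
`[0,1]²` into itself and preserves each edge: `Vᵢ = 0 = ∂_{1−i}Vᵢ` on `{xᵢ ∈ {0,1}}`;
`W i j = ∂ⱼVᵢ`, `M i = ∂₀∂₁Vᵢ = ∂₁∂₀Vᵢ`), the straight-line isotopy `Φᵤ = id + uV` and the
Liouville identity `∂ᵤ[(f∘Φᵤ)Jᵤ] = ∂₀[(f∘Φᵤ)C₀] + ∂₁[(f∘Φᵤ)C₁]` (`J = det DΦᵤ`,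
`C = adj(DΦᵤ)V`, fluxes vanishing on the edges) give three fibrewise Stokes elements on `[0,1]³`
(directions `2, 1, 0`) summing to `f − (f∘Φ)·det DΦ`. [cite: KontsevichZagier2001, §1.2 rule (2)] -/
theorem stub_isotopyTransport2 :
    ∀ (U : Set (Fin 2 → ℝ)) (f : (Fin 2 → ℝ) → ℝ) (f' : (Fin 2 → ℝ) → (Fin 2 → ℝ) →L[ℝ] ℝ)
      (V : Fin 2 → (Fin 2 → ℝ) → ℝ) (W : Fin 2 → Fin 2 → (Fin 2 → ℝ) → ℝ) (M : Fin 2 → (Fin 2 → ℝ) → ℝ),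
      IsOpen U → Set.pi Set.univ (fun _ : Fin 2 => Set.Icc (0:ℝ) 1) ⊆ U →
      IsSemialgebraicFunOn ℚ (Set.pi Set.univ (fun _ : Fin 2 => Set.Icc (0:ℝ) 1)) f →
      (∀ i, IsSemialgebraicFunOn ℚ (Set.pi Set.univ (fun _ : Fin 2 => Set.Icc (0:ℝ) 1)) (fun p => f' p (Pi.single i 1))) →
      ContinuousOn f (Set.pi Set.univ (fun _ : Fin 2 => Set.Icc (0:ℝ) 1)) →
      (∀ i, ContinuousOn (fun p => f' p (Pi.single i 1)) (Set.pi Set.univ (fun _ : Fin 2 => Set.Icc (0:ℝ) 1))) →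
      (∀ p ∈ U, HasFDerivAt f (f' p) p) →
      (∀ i, IsSemialgebraicFunOn ℚ (Set.pi Set.univ (fun _ : Fin 2 => Set.Icc (0:ℝ) 1)) (V i)) →
      (∀ i j, IsSemialgebraicFunOn ℚ (Set.pi Set.univ (fun _ : Fin 2 => Set.Icc (0:ℝ) 1)) (W i j)) →
      (∀ i, IsSemialgebraicFunOn ℚ (Set.pi Set.univ (fun _ : Fin 2 => Set.Icc (0:ℝ) 1)) (M i)) →
      (∀ i, ContinuousOn (V i) (Set.pi Set.univ (fun _ : Fin 2 => Set.Icc (0:ℝ) 1))) →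
      (∀ i j, ContinuousOn (W i j) (Set.pi Set.univ (fun _ : Fin 2 => Set.Icc (0:ℝ) 1))) →
      (∀ i, ContinuousOn (M i) (Set.pi Set.univ (fun _ : Fin 2 => Set.Icc (0:ℝ) 1))) →
      (∀ i j, ∀ x ∈ Set.pi Set.univ (fun _ : Fin 2 => Set.Icc (0:ℝ) 1), x j ∈ Set.Ioo (0:ℝ) 1 →
        HasDerivAt (fun s : ℝ => V i (Function.update x j s)) (W i j x) (x j)) →
      (∀ i, ∀ x ∈ Set.pi Set.univ (fun _ : Fin 2 => Set.Icc (0:ℝ) 1), x 0 ∈ Set.Ioo (0:ℝ) 1 →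
        HasDerivAt (fun s : ℝ => W i 1 (Function.update x 0 s)) (M i x) (x 0)) →
      (∀ i, ∀ x ∈ Set.pi Set.univ (fun _ : Fin 2 => Set.Icc (0:ℝ) 1), x 1 ∈ Set.Ioo (0:ℝ) 1 →
        HasDerivAt (fun s : ℝ => W i 0 (Function.update x 1 s)) (M i x) (x 1)) →
      (∀ x ∈ Set.pi Set.univ (fun _ : Fin 2 => Set.Icc (0:ℝ) 1), ∀ i, x i + V i x ∈ Set.Icc (0:ℝ) 1) →
      (∀ x ∈ Set.pi Set.univ (fun _ : Fin 2 => Set.Icc (0:ℝ) 1), ∀ i, (x i = 0 ∨ x i = 1) →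
        V i x = 0 ∧ W i (Fin.rev i) x = 0) →
      ∃ (G D : Fin 3 → (Fin 3 → ℝ) → ℝ) (r : Fin 3 → IntegralRep 3),
        (∀ j, IsSemialgebraicFunOn ℚ (Set.pi Set.univ (fun _ : Fin 3 => Set.Icc (0:ℝ) 1)) (G j) ∧
          IsSemialgebraicFunOn ℚ (Set.pi Set.univ (fun _ : Fin 3 => Set.Icc (0:ℝ) 1)) (D j) ∧
          (∃ B : ℝ, ∀ x ∈ Set.pi Set.univ (fun _ : Fin 3 => Set.Icc (0:ℝ) 1), |(G j) x| ≤ B) ∧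
          (∀ x ∈ Set.pi Set.univ (fun _ : Fin 3 => Set.Icc (0:ℝ) 1),
            ContinuousOn (fun s : ℝ => (G j) (Function.update x (Fin.rev j) s)) (Set.Icc (0:ℝ) 1)) ∧
          (∀ x ∈ Set.pi Set.univ (fun _ : Fin 3 => Set.Icc (0:ℝ) 1), x (Fin.rev j) ∈ Set.Ioo (0:ℝ) 1 →
            HasDerivAt (fun s : ℝ => (G j) (Function.update x (Fin.rev j) s)) ((D j) x) (x (Fin.rev j)))) ∧
        (∀ j, (r j).domain = Set.pi Set.univ (fun _ : Fin 3 => Set.Icc (0:ℝ) 1) ∧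
          ∀ x ∈ Set.pi Set.univ (fun _ : Fin 3 => Set.Icc (0:ℝ) 1), (r j).integrand x =
            D j x - (G j (Function.update x (Fin.rev j) 1) - G j (Function.update x (Fin.rev j) 0))) ∧
        ∀ x ∈ Set.pi Set.univ (fun _ : Fin 3 => Set.Icc (0:ℝ) 1),
          f ![x 0, x 1] - f ![x 0 + V 0 ![x 0, x 1], x 1 + V 1 ![x 0, x 1]] *
              ((1 + W 0 0 ![x 0, x 1]) * (1 + W 1 1 ![x 0, x 1]) - W 0 1 ![x 0, x 1] * W 1 0 ![x 0, x 1]) =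
            ∑ j, (r j).integrand x := by
  intro U f f' V W M _ hSU hf hf' hfc hf'c hfd hV hW hM hVc hWc hMc hVd hM0 hM1 hVI hface
  -- the square `S`, the cube `T` and what holds on them
  set S : Set (Fin 2 → ℝ) := Set.pi Set.univ (fun _ : Fin 2 => Set.Icc (0:ℝ) 1)
  set T : Set (Fin 3 → ℝ) := Set.pi Set.univ (fun _ : Fin 3 => Set.Icc (0:ℝ) 1) with hT
  have hTsa : IsSemialgebraic ℚ T := by rw [hT, ← cube_eq_pi]; exact isSemialgebraic_cube
  have hTc : IsCompact T := isCompact_univ_pi fun _ => isCompact_Icc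
  have hr0 : Fin.rev (0 : Fin 3) = 2 := rfl
  have hr1 : Fin.rev (1 : Fin 3) = 1 := rfl
  have hr2 : Fin.rev (2 : Fin 3) = 0 := rfl
  have h10 : (1 : Fin 3) ≠ 0 := by decide
  have h20 : (2 : Fin 3) ≠ 0 := by decide
  have h01 : (0 : Fin 3) ≠ 1 := by decide
  have h21 : (2 : Fin 3) ≠ 1 := by decide
  have h02 : (0 : Fin 3) ≠ 2 := by decide
  have h12 : (1 : Fin 3) ≠ 2 := by decide
  have hmem : ∀ x ∈ T, ∀ i, x i ∈ Set.Icc (0:ℝ) 1 := fun x hx i => (Set.mem_univ_pi.mp hx) i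
  have hupd : ∀ x ∈ T, ∀ (j : Fin 3), ∀ s ∈ Set.Icc (0:ℝ) 1, Function.update x j s ∈ T := by
    intro x hx j s hs
    refine Set.mem_univ_pi.mpr fun i => ?_
    rcases eq_or_ne i j with rfl | hij
    · simpa using hs
    · rw [Function.update_of_ne hij]
      exact hmem x hx i
  have hI0 : (0:ℝ) ∈ Set.Icc (0:ℝ) 1 := ⟨le_rfl, zero_le_one⟩
  have hI1 : (1:ℝ) ∈ Set.Icc (0:ℝ) 1 := ⟨zero_le_one, le_rfl⟩
  -- the base point `p = (x₀, x₁)`, the end point `Φ p` and the isotopy point `Φᵤ p` lie in `S`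
  have hpS : ∀ x ∈ T, ![x 0, x 1] ∈ S := fun x hx => iso2_vec2_mem (hmem x hx 0) (hmem x hx 1)
  have hΦI : ∀ x ∈ T, x 0 + V 0 ![x 0, x 1] ∈ Set.Icc (0:ℝ) 1 ∧
      x 1 + V 1 ![x 0, x 1] ∈ Set.Icc (0:ℝ) 1 :=
    fun x hx => ⟨hVI _ (hpS x hx) 0, hVI _ (hpS x hx) 1⟩
  -- atoms on the cube: `v i = Vᵢ(p)`, `w i j = ∂ⱼVᵢ(p)`, `m i = Mᵢ(p)`
  set v : Fin 2 → (Fin 3 → ℝ) → ℝ := fun i y => V i ![y 0, y 1] with hv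
  set w : Fin 2 → Fin 2 → (Fin 3 → ℝ) → ℝ := fun i j y => W i j ![y 0, y 1] with hw
  set m : Fin 2 → (Fin 3 → ℝ) → ℝ := fun i y => M i ![y 0, y 1] with hm
  have hΦS : ∀ x ∈ T, ![x 0 + v 0 x, x 1 + v 1 x] ∈ S := fun x hx =>
    iso2_vec2_mem (hΦI x hx).1 (hΦI x hx).2
  have hΨS : ∀ x ∈ T, ![x 0 + x 2 * v 0 x, x 1 + x 2 * v 1 x] ∈ S := fun x hx =>
    iso2_vec2_mem (iso2_combo_mem_Icc (hmem x hx 0) (hΦI x hx).1 (hmem x hx 2))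
      (iso2_combo_mem_Icc (hmem x hx 1) (hΦI x hx).2 (hmem x hx 2))
  -- `f`, `f₀ = ∂₀f`, `f₁ = ∂₁f` at the isotopy point, `f` at the base point and at `Φ p`
  set F : (Fin 3 → ℝ) → ℝ := fun y => f ![y 0 + y 2 * v 0 y, y 1 + y 2 * v 1 y] with hF
  set F0 : (Fin 3 → ℝ) → ℝ :=
    fun y => f' ![y 0 + y 2 * v 0 y, y 1 + y 2 * v 1 y] (Pi.single 0 1) with hF0
  set F1 : (Fin 3 → ℝ) → ℝ :=
    fun y => f' ![y 0 + y 2 * v 0 y, y 1 + y 2 * v 1 y] (Pi.single 1 1) with hF1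
  set fπ : (Fin 3 → ℝ) → ℝ := fun y => f ![y 0, y 1] with hfπ
  set fΦ : (Fin 3 → ℝ) → ℝ := fun y => f ![y 0 + v 0 y, y 1 + v 1 y] with hfΦ
  -- Jacobian `Jᵤ`, cofactor fluxes `C₀, C₁`, boundary term `E = f(Φ p) J₁ − f p`
  set J : (Fin 3 → ℝ) → ℝ :=
    fun y => (1 + y 2 * w 0 0 y) * (1 + y 2 * w 1 1 y) - y 2 * w 0 1 y * (y 2 * w 1 0 y) with hJ
  set C0 : (Fin 3 → ℝ) → ℝ := fun y => (1 + y 2 * w 1 1 y) * v 0 y - y 2 * w 0 1 y * v 1 y with hC0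
  set C1 : (Fin 3 → ℝ) → ℝ := fun y => (1 + y 2 * w 0 0 y) * v 1 y - y 2 * w 1 0 y * v 0 y with hC1
  set E : (Fin 3 → ℝ) → ℝ :=
    fun y => fΦ y * ((1 + w 0 0 y) * (1 + w 1 1 y) - w 0 1 y * w 1 0 y) - fπ y with hE
  -- the primitives `G₀ = (f∘Φᵤ) Jᵤ`, `G₁ = −(f∘Φᵤ) C₁`, `G₂ = −(f∘Φᵤ) C₀` and their fibre
  -- derivatives `D₀ = ∂ᵤG₀`, `D₁ = ∂₁G₁`, `D₂ = ∂₀G₂`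
  set G0 : (Fin 3 → ℝ) → ℝ := fun y => F y * J y with hG0
  set G1 : (Fin 3 → ℝ) → ℝ := fun y => -(F y * C1 y) with hG1
  set G2 : (Fin 3 → ℝ) → ℝ := fun y => -(F y * C0 y) with hG2
  set D0 : (Fin 3 → ℝ) → ℝ := fun y => (F0 y * v 0 y + F1 y * v 1 y) * J y +
    F y * (w 0 0 y * (1 + y 2 * w 1 1 y) + (1 + y 2 * w 0 0 y) * w 1 1 y -
      (w 0 1 y * (y 2 * w 1 0 y) + y 2 * w 0 1 y * w 1 0 y)) with hD0
  set D1 : (Fin 3 → ℝ) → ℝ := fun y =>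
    -((F0 y * (y 2 * w 0 1 y) + F1 y * (1 + y 2 * w 1 1 y)) * C1 y +
      F y * (y 2 * m 0 y * v 1 y + (1 + y 2 * w 0 0 y) * w 1 1 y -
        (y 2 * m 1 y * v 0 y + y 2 * w 1 0 y * w 0 1 y))) with hD1
  set D2 : (Fin 3 → ℝ) → ℝ := fun y =>
    -((F0 y * (1 + y 2 * w 0 0 y) + F1 y * (y 2 * w 1 0 y)) * C0 y +
      F y * (y 2 * m 1 y * v 0 y + (1 + y 2 * w 1 1 y) * w 0 0 y -
        (y 2 * m 0 y * v 1 y + y 2 * w 0 1 y * w 1 0 y))) with hD2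
  -- semialgebraicity and continuity on the cube (BCR Prop. 2.2.6)
  have hx0 := iso2_sc_apply hTsa 0
  have hx1 := iso2_sc_apply hTsa 1
  have hu := iso2_sc_apply hTsa 2
  have h1 := iso2_sc_one hTsa
  have hvT : ∀ i, IsSemialgebraicFunOn ℚ T (v i) ∧ ContinuousOn (v i) T := fun i =>
    iso2_sc_comp ⟨hV i, hVc i⟩ hx0 hx1 hpS
  have hwT : ∀ i j, IsSemialgebraicFunOn ℚ T (w i j) ∧ ContinuousOn (w i j) T := fun i j =>
    iso2_sc_comp ⟨hW i j, hWc i j⟩ hx0 hx1 hpS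
  have hmT : ∀ i, IsSemialgebraicFunOn ℚ T (m i) ∧ ContinuousOn (m i) T := fun i =>
    iso2_sc_comp ⟨hM i, hMc i⟩ hx0 hx1 hpS
  have hΨ0 := iso2_sc_add hx0 (iso2_sc_mul hu (hvT 0))
  have hΨ1 := iso2_sc_add hx1 (iso2_sc_mul hu (hvT 1))
  have hFT : IsSemialgebraicFunOn ℚ T F ∧ ContinuousOn F T := iso2_sc_comp ⟨hf, hfc⟩ hΨ0 hΨ1 hΨS
  have hF0T : IsSemialgebraicFunOn ℚ T F0 ∧ ContinuousOn F0 T :=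
    iso2_sc_comp (h := fun p => f' p (Pi.single 0 1)) ⟨hf' 0, hf'c 0⟩ hΨ0 hΨ1 hΨS
  have hF1T : IsSemialgebraicFunOn ℚ T F1 ∧ ContinuousOn F1 T :=
    iso2_sc_comp (h := fun p => f' p (Pi.single 1 1)) ⟨hf' 1, hf'c 1⟩ hΨ0 hΨ1 hΨS
  have hfπT : IsSemialgebraicFunOn ℚ T fπ ∧ ContinuousOn fπ T := iso2_sc_comp ⟨hf, hfc⟩ hx0 hx1 hpS
  have hfΦT : IsSemialgebraicFunOn ℚ T fΦ ∧ ContinuousOn fΦ T :=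
    iso2_sc_comp ⟨hf, hfc⟩ (iso2_sc_add hx0 (hvT 0)) (iso2_sc_add hx1 (hvT 1)) hΦS
  have hJT : IsSemialgebraicFunOn ℚ T J ∧ ContinuousOn J T :=
    iso2_sc_sub (iso2_sc_mul (iso2_sc_add h1 (iso2_sc_mul hu (hwT 0 0)))
      (iso2_sc_add h1 (iso2_sc_mul hu (hwT 1 1))))
      (iso2_sc_mul (iso2_sc_mul hu (hwT 0 1)) (iso2_sc_mul hu (hwT 1 0)))
  have hC0T : IsSemialgebraicFunOn ℚ T C0 ∧ ContinuousOn C0 T :=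
    iso2_sc_sub (iso2_sc_mul (iso2_sc_add h1 (iso2_sc_mul hu (hwT 1 1))) (hvT 0))
      (iso2_sc_mul (iso2_sc_mul hu (hwT 0 1)) (hvT 1))
  have hC1T : IsSemialgebraicFunOn ℚ T C1 ∧ ContinuousOn C1 T :=
    iso2_sc_sub (iso2_sc_mul (iso2_sc_add h1 (iso2_sc_mul hu (hwT 0 0))) (hvT 1))
      (iso2_sc_mul (iso2_sc_mul hu (hwT 1 0)) (hvT 0))
  have hET : IsSemialgebraicFunOn ℚ T E ∧ ContinuousOn E T :=
    iso2_sc_sub (iso2_sc_mul hfΦT (iso2_sc_sub (iso2_sc_mul (iso2_sc_add h1 (hwT 0 0))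
      (iso2_sc_add h1 (hwT 1 1))) (iso2_sc_mul (hwT 0 1) (hwT 1 0)))) hfπT
  have hG0T : IsSemialgebraicFunOn ℚ T G0 ∧ ContinuousOn G0 T := iso2_sc_mul hFT hJT
  have hG1T : IsSemialgebraicFunOn ℚ T G1 ∧ ContinuousOn G1 T := iso2_sc_neg (iso2_sc_mul hFT hC1T)
  have hG2T : IsSemialgebraicFunOn ℚ T G2 ∧ ContinuousOn G2 T := iso2_sc_neg (iso2_sc_mul hFT hC0T)
  have hD0T : IsSemialgebraicFunOn ℚ T D0 ∧ ContinuousOn D0 T :=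
    iso2_sc_add
      (iso2_sc_mul (iso2_sc_add (iso2_sc_mul hF0T (hvT 0)) (iso2_sc_mul hF1T (hvT 1))) hJT)
      (iso2_sc_mul hFT (iso2_sc_sub
        (iso2_sc_add (iso2_sc_mul (hwT 0 0) (iso2_sc_add h1 (iso2_sc_mul hu (hwT 1 1))))
          (iso2_sc_mul (iso2_sc_add h1 (iso2_sc_mul hu (hwT 0 0))) (hwT 1 1)))
        (iso2_sc_add (iso2_sc_mul (hwT 0 1) (iso2_sc_mul hu (hwT 1 0)))
          (iso2_sc_mul (iso2_sc_mul hu (hwT 0 1)) (hwT 1 0)))))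
  have hD1T : IsSemialgebraicFunOn ℚ T D1 ∧ ContinuousOn D1 T :=
    iso2_sc_neg (iso2_sc_add
      (iso2_sc_mul (iso2_sc_add (iso2_sc_mul hF0T (iso2_sc_mul hu (hwT 0 1)))
        (iso2_sc_mul hF1T (iso2_sc_add h1 (iso2_sc_mul hu (hwT 1 1))))) hC1T)
      (iso2_sc_mul hFT (iso2_sc_sub
        (iso2_sc_add (iso2_sc_mul (iso2_sc_mul hu (hmT 0)) (hvT 1))
          (iso2_sc_mul (iso2_sc_add h1 (iso2_sc_mul hu (hwT 0 0))) (hwT 1 1)))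
        (iso2_sc_add (iso2_sc_mul (iso2_sc_mul hu (hmT 1)) (hvT 0))
          (iso2_sc_mul (iso2_sc_mul hu (hwT 1 0)) (hwT 0 1))))))
  have hD2T : IsSemialgebraicFunOn ℚ T D2 ∧ ContinuousOn D2 T :=
    iso2_sc_neg (iso2_sc_add
      (iso2_sc_mul (iso2_sc_add (iso2_sc_mul hF0T (iso2_sc_add h1 (iso2_sc_mul hu (hwT 0 0))))
        (iso2_sc_mul hF1T (iso2_sc_mul hu (hwT 1 0)))) hC0T)
      (iso2_sc_mul hFT (iso2_sc_sub
        (iso2_sc_add (iso2_sc_mul (iso2_sc_mul hu (hmT 1)) (hvT 0))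
          (iso2_sc_mul (iso2_sc_add h1 (iso2_sc_mul hu (hwT 1 1))) (hwT 0 0)))
        (iso2_sc_add (iso2_sc_mul (iso2_sc_mul hu (hmT 0)) (hvT 1))
          (iso2_sc_mul (iso2_sc_mul hu (hwT 0 1)) (hwT 1 0))))))
  -- packaged as `Fin 3`-families; the first integrand carries the boundary values of `G₀`
  set G : Fin 3 → (Fin 3 → ℝ) → ℝ := ![G0, G1, G2] with hG
  set D : Fin 3 → (Fin 3 → ℝ) → ℝ := ![D0, D1, D2] with hD
  set I : Fin 3 → (Fin 3 → ℝ) → ℝ := ![fun y => D0 y - E y, D1, D2] with hI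
  have hGT : ∀ j, IsSemialgebraicFunOn ℚ T (G j) ∧ ContinuousOn (G j) T :=
    iso2_forall_fin_three hG0T hG1T hG2T
  have hDT : ∀ j, IsSemialgebraicFunOn ℚ T (D j) ∧ ContinuousOn (D j) T :=
    iso2_forall_fin_three hD0T hD1T hD2T
  have hIT : ∀ j, IsSemialgebraicFunOn ℚ T (I j) ∧ ContinuousOn (I j) T :=
    iso2_forall_fin_three (iso2_sc_sub hD0T hET) hD1T hD2T
  -- boundary values of `G₀`: `u = 1` gives `f(Φ p) J₁`, `u = 0` gives `f p`
  have hG0_one : ∀ x, G 0 (Function.update x 2 1) =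
      fΦ x * ((1 + w 0 0 x) * (1 + w 1 1 x) - w 0 1 x * w 1 0 x) := fun x => by
    simp only [hG, hG0, hF, hJ, hfΦ, hv, hw, Matrix.cons_val_zero, Function.update_self,
      Function.update_of_ne h02, Function.update_of_ne h12, one_mul]
  have hG0_zero : ∀ x, G 0 (Function.update x 2 0) = fπ x := fun x => by
    simp only [hG, hG0, hF, hJ, hfπ, hv, hw, Matrix.cons_val_zero, Function.update_self,
      Function.update_of_ne h02, Function.update_of_ne h12, zero_mul, add_zero, sub_zero, mul_one]
  -- boundary values of `G₁`, `G₂`: the fluxes vanish on the edges (face hypotheses)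
  have hG1_bd : ∀ x ∈ T, ∀ c : ℝ, (c = 0 ∨ c = 1) → G 1 (Function.update x 1 c) = 0 := by
    intro x hx c hc
    have hcI : c ∈ Set.Icc (0:ℝ) 1 := by rcases hc with rfl | rfl; exacts [hI0, hI1]
    obtain ⟨hV1, hW10⟩ := hface ![x 0, c] (iso2_vec2_mem (hmem x hx 0) hcI) 1 hc
    have hr : Fin.rev (1 : Fin 2) = 0 := rfl
    rw [hr] at hW10
    simp only [hG, hG1, hC1, hv, hw, Matrix.cons_val_one, Matrix.cons_val_zero,
      Function.update_self, Function.update_of_ne h01, Function.update_of_ne h21, hV1, hW10,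
      mul_zero, zero_mul, sub_zero, neg_zero]
  have hG2_bd : ∀ x ∈ T, ∀ c : ℝ, (c = 0 ∨ c = 1) → G 2 (Function.update x 0 c) = 0 := by
    intro x hx c hc
    have hcI : c ∈ Set.Icc (0:ℝ) 1 := by rcases hc with rfl | rfl; exacts [hI0, hI1]
    obtain ⟨hV0, hW01⟩ := hface ![c, x 1] (iso2_vec2_mem hcI (hmem x hx 1)) 0 hc
    have hr : Fin.rev (0 : Fin 2) = 1 := rfl
    rw [hr] at hW01
    simp only [hG, hG2, hC0, hv, hw, Matrix.cons_val_two, Matrix.tail_cons, Matrix.head_cons,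
      Function.update_self, Function.update_of_ne h10, Function.update_of_ne h20, hV0, hW01,
      mul_zero, zero_mul, sub_zero, neg_zero]
  -- bounds on the compact cube and continuity along closed fibres
  have hGbd : ∀ j, ∃ B : ℝ, ∀ x ∈ T, |G j x| ≤ B := fun j => by
    obtain ⟨B, hB⟩ := hTc.exists_bound_of_continuousOn (hGT j).2
    exact ⟨B, fun x hx => by simpa only [Real.norm_eq_abs] using hB x hx⟩
  have hGfib : ∀ j, ∀ x ∈ T,
      ContinuousOn (fun s : ℝ => G j (Function.update x (Fin.rev j) s)) (Set.Icc (0:ℝ) 1) := by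
    intro j x hx
    have hc : Continuous fun s : ℝ => Function.update x (Fin.rev j) s :=
      continuous_const.update (Fin.rev j) continuous_id
    exact (hGT j).2.comp hc.continuousOn fun s hs => hupd x hx _ s hs
  -- derivatives along open fibres (the two-dimensional Liouville identity, term by term)
  have hGder : ∀ j, ∀ x ∈ T, x (Fin.rev j) ∈ Set.Ioo (0:ℝ) 1 →
      HasDerivAt (fun s : ℝ => G j (Function.update x (Fin.rev j) s)) (D j x) (x (Fin.rev j)) := by
    refine iso2_forall_fin_three (fun x hx hx2 => ?_) (fun x hx hx1 => ?_) (fun x hx hx0 => ?_)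
    · -- direction `u = x₂` of `G₀ = (f∘Φᵤ) Jᵤ`
      rw [hr0] at hx2 ⊢
      have key := iso2_hasDerivAt_dir2 (w 0 0 x) (w 0 1 x) (w 1 0 x) (w 1 1 x)
        (hfd _ (hSU (hΨS x hx)))
      refine (key.congr_of_eventuallyEq (Filter.Eventually.of_forall fun s => ?_)).congr_deriv ?_
      · simp only [hG, hG0, hF, hJ, hv, hw, Matrix.cons_val_zero, Function.update_self,
          Function.update_of_ne h02, Function.update_of_ne h12]
      · simp only [hD, hD0, hF, hF0, hF1, hJ, hv, hw, Matrix.cons_val_zero]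
    · -- direction `x₁` of `G₁ = −(f∘Φᵤ) C₁`
      rw [hr1] at hx1 ⊢
      have hp := hpS x hx
      have key := iso2_hasDerivAt_dir1 (iso2_fibre_one (hVd 0 1 _ hp hx1))
        (iso2_fibre_one (hVd 1 1 _ hp hx1)) (iso2_fibre_one (hM1 0 _ hp hx1))
        (iso2_fibre_one (hM1 1 _ hp hx1)) (c := x 2) (hfd _ (hSU (hΨS x hx)))
      refine (key.congr_of_eventuallyEq (Filter.Eventually.of_forall fun s => ?_)).congr_deriv ?_
      · simp only [hG, hG1, hF, hC1, hv, hw, Matrix.cons_val_one, Matrix.cons_val_zero,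
          Function.update_self, Function.update_of_ne h01, Function.update_of_ne h21]
      · simp only [hD, hD1, hF, hF0, hF1, hC1, hv, hw, hm, Matrix.cons_val_one,
          Matrix.cons_val_zero]
    · -- direction `x₀` of `G₂ = −(f∘Φᵤ) C₀`
      rw [hr2] at hx0 ⊢
      have hp := hpS x hx
      have key := iso2_hasDerivAt_dir0 (iso2_fibre_zero (hVd 0 0 _ hp hx0))
        (iso2_fibre_zero (hVd 1 0 _ hp hx0)) (iso2_fibre_zero (hM0 0 _ hp hx0))
        (iso2_fibre_zero (hM0 1 _ hp hx0)) (c := x 2) (hfd _ (hSU (hΨS x hx)))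
      refine (key.congr_of_eventuallyEq (Filter.Eventually.of_forall fun s => ?_)).congr_deriv ?_
      · simp only [hG, hG2, hF, hC0, hv, hw, Matrix.cons_val_two, Matrix.tail_cons,
          Matrix.head_cons, Function.update_self, Function.update_of_ne h10,
          Function.update_of_ne h20]
      · simp only [hD, hD2, hF, hF0, hF1, hC0, hv, hw, hm, Matrix.cons_val_two,
          Matrix.tail_cons, Matrix.head_cons]
  -- the three closed-cube representations
  let r : Fin 3 → IntegralRep 3 := fun j =>
    { domain := T
      integrand := I j
      isSemialgebraic_domain := hTsa
      isSemialgebraicFunOn_integrand := (hIT j).1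
      integrableOn := (hIT j).2.integrableOn_compact hTc }
  refine ⟨G, D, r, fun j => ⟨(hGT j).1, (hDT j).1, hGbd j, hGfib j, hGder j⟩, ?_, fun x _ => ?_⟩
  · -- the integrand clauses
    refine iso2_forall_fin_three ⟨rfl, fun x _ => ?_⟩ ⟨rfl, fun x hx => ?_⟩ ⟨rfl, fun x hx => ?_⟩
    · show I 0 x =
        D 0 x - (G 0 (Function.update x (Fin.rev 0) 1) - G 0 (Function.update x (Fin.rev 0) 0))
      rw [hr0, hG0_one, hG0_zero]
      simp only [hI, hD, hE, Matrix.cons_val_zero]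
    · show I 1 x =
        D 1 x - (G 1 (Function.update x (Fin.rev 1) 1) - G 1 (Function.update x (Fin.rev 1) 0))
      rw [hr1, hG1_bd x hx 1 (Or.inr rfl), hG1_bd x hx 0 (Or.inl rfl), sub_zero, sub_zero]
      simp only [hI, hD, Matrix.cons_val_one, Matrix.cons_val_zero]
    · show I 2 x =
        D 2 x - (G 2 (Function.update x (Fin.rev 2) 1) - G 2 (Function.update x (Fin.rev 2) 0))
      rw [hr2, hG2_bd x hx 1 (Or.inr rfl), hG2_bd x hx 0 (Or.inl rfl), sub_zero, sub_zero]
      simp only [hI, hD, Matrix.cons_val_two, Matrix.tail_cons, Matrix.head_cons]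
  · -- the identity `f p − f(Φ p) J₁ = (D₀ − E) + D₁ + D₂`, as `D₀ + D₁ + D₂ = 0` (Liouville)
    show _ = ∑ j, I j x
    rw [Fin.sum_univ_three]
    simp only [hI, hE, hfΦ, hfπ, hD0, hD1, hD2, hJ, hC0, hC1, hv, hw, hm, Matrix.cons_val_zero,
      Matrix.cons_val_one, Matrix.cons_val_two, Matrix.tail_cons, Matrix.head_cons]
    ring

end Summit.KontsevichZagierPeriods.KontsevichZagierPeriods.Cruxes.StokesGeneration.FibrewiseStokes
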